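/-
Copyright (c) 2026 the pub-hodgecm-mathlib formalisation cell (harness21).  Prover seat hodgecm-mathlib-K2E1-p10 (g2), Track B ∕ K2-LIT (build stream 29), h413 = `stmt-HodgeConjecture-24833`,
route of record `HCCMUnconditional`, ROADCARD «5Res ENDGAME BY FAMILIES» §2 C7; dealer K2E1-plan (g7) deals (155)∕(169)∕(217)∕(232) — THE C7 HEAD `K2E1PseudoEisensteinFamilyDecompositionU2`:
`E^{K′} ⊆ closure Σ_χ span{[quotFun (E (f(H)·φ))] : φ ∈ chiSectionSpace χ K′ 1}` (assembly of ★ P1b, ★ F3b, ★ F3b′, ★ F3d-β, ★ F3d-γ with the two remaining bricks F3d-α (torus families) and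
F3d-δ (nice classes are L²) HYPOTHESIS-FIRST).
-/
import Summits.HodgeConjecture.HodgeConjecture.Theorems.K2E1PseudoEisensteinNiceGeneratorsU                   -- ★ P1b (this seat): `orthogonal_inf_invariants_eq_topologicalClosure_span_nice`
import Summits.HodgeConjecture.HodgeConjecture.Theorems.K2E1PseudoEisensteinBorelPeriodizationContinuousU2     -- ★ F3b′ (K2E1-p15): `continuous_inv_periodization`, band, bound; transitively ★ F3b
import Summits.HodgeConjecture.HodgeConjecture.Theorems.K2E1ChiIsotypicPureTensorDecompositionU2              -- ★ F3d-β (this seat): `exists_sum_pureTensor_eq_norm_le`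
import Summits.HodgeConjecture.HodgeConjecture.Theorems.K2E1EisensteinSupNormBandBoundCMTwo                    -- ★ F3d-γ (this seat): `exists_const_norm_toLp_sub_sum_le_cm`, `eisensteinSeriesU_sub_finset_sum_of_band`, `sum_smul_toLp_eq`
import Summits.HodgeConjecture.HodgeConjecture.Theorems.K2E1BLIotaUnfoldingU                                  -- ★ (K2E1-p08): `borelHeight_arithmeticBorel_mul'`
import HarnessLib

/-!
# h413 ∕ Track B «K2-LIT», ROADCARD «5Res BY FAMILIES» §2 C7 — THE HEAD `K2E1PseudoEisensteinFamilyDecompositionU2`: for the CM pair and an open compact `K′ ≤ U(J₂)(𝔸_{L⁺})`,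
# **`(L²_cusp)ᗮ ∩ L²(X)^{K′} ⊆ closure ( ⨆_χ span { [quotFun (E (f(H)·φ))] : f ∈ C_c((0,∞)), φ ∈ chiSectionSpace χ K′ 1 } )`** — the `K′`-fixed part of the Eisenstein space is generated by
# the Bernstein–Lapid ∕ (χ,τ) pure tensors of ★ W-b ∕ H-χ ∕ C9, family by family

Cell `pub/hodgecm-mathlib`, crux h413 = `stmt-HodgeConjecture-24833`, route of record `HCCMUnconditional`; dealer K2E1-plan (g7) (217)∕(232).  THEOREMS ONLY (no `def`, no `instance`, no notation,
no named-fact hypothesis, no `sorry`); lane `--supports stmt-HodgeConjecture-24833 --as helper` (count-neutral).  Closes no socket.  WORLD: Mok's `quasiSplit L⁺ L c 2` (= `cmDatum L 2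
((antidiagonal 2).over L)` by `rfl`), the world of ★ `eisensteinSeriesU`∕`borelHeight`∕`chiSectionSpace`; the cuspidal datum enters HYPOTHESIS-FIRST as a closed `R`-stable `W` with
`Wᗮ = closure span Θ` (`hE`, ★ f1 `cmCuspidalSubspace_orthogonal_eq_topologicalClosure_span_two` transported by the consumer along ★ `antidiagOne_eq_over`) over parabolic data `𝔓`
all of whose radicals are `N(𝔸)` (`h𝔓`; the Borel is the only proper parabolic of `U(1,1)`).

THE TWO HYPOTHESIS-FIRST BRICKS (dealt (232) to K2E1-p12 (g2) ∕ K2E1-p15 (g0); the binder shapes ARE their agreed heads, so the consumer discharges them by name):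
* `hα` = F3d-α `K2E1NormOneTorusFamilyActionU2` (K2E1-p12): a NICE `ψ` (continuous, left-`N(𝔸)`- and left-`B(F)`-invariant, right-`K′`-invariant, supported in a height band `[a,b]`, `a > 0`) is
  UNIFORMLY approximated by finite combinations `Σ_{χ∈s} coef_χ · P_χ` of nice `χ`-ISOTYPIC functions (`P_χ(b g) = χ(b₀₀) P_χ(g)` for norm-one `b ∈ B(𝔸)`, `χ` trivial on the real ray), by
  ★ F3c `exists_finset_character_isotypic_approx` on `N(𝔸)B(F)∖G(𝔸)` with the compact torus `T(𝔸)¹⧸T(F)`;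
* `hδ` = F3d-δ `K2E1EisensteinNiceClassCMTwo` (K2E1-p15): the descent `quotFun (E u)` of the Eisenstein series of a continuous, left-`B(F)`-invariant, bounded, band-supported `u` is in `L²(X, μ)`.

THE PROOF.  ★ P1b: `Wᗮ ∩ H^{K′} = closure span Θ^{K′,nice}`.  A generator is `[θ_Φ]` with `Φ` continuous, bounded, vanishing off `C·N(𝔸)`, left-`K′`-invariant; by ★ F3b `[θ_Φ] = [quotFun (E ψ)]`,
`ψ = (Φ_B)^∨`, and by ★ F3b∕F3b′ `ψ` is nice (§1).  `hα` with `ε = 1∕(n+1)` gives `s_n, coef_n, P_n`; ★ F3d-γ turns `sup|ψ − Σ coef P| ≤ ε` into `‖[E ψ] − Σ coef_χ [E P_χ]‖₂ ≤ μ(X)^{1/2} C_{a∕2} ε`;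
★ F3d-β writes each `P_χ = Σ_i f_i(H)·φ_i` with termwise domination, so `[E P_χ] = Σ_i [E (f_i(H)·φ_i)]` (★ F3d-γ linearity on the band class) lies in the `χ`-family span (§2); hence
`[θ_Φ] ∈ closure(⨆_χ span)` and the head follows (§3).

* §1 `isClosed_adelicUnipotent_quasiSplit_cm`, `pureTensor_arithmeticBorel_mul` (★ `borelHeight_arithmeticBorel_mul'`), `eisensteinSeriesU_eq_sum_of_eq_sum` (band-class linearity for an exact finite decomposition).
* §2 **`toLp_quotFun_eisensteinSeriesU_mem_span_family`** (`[E P_χ] ∈ span(gen χ)`).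
* §3 **`orthogonal_inf_invariants_le_topologicalClosure_iSup_family`** (THE C7 HEAD, hypothesis-first on `hα`, `hδ`).

HONEST LABEL: HC_CM is proved only modulo the 7 printed citations (2 remaining named inputs: hLiu418 = `stmt-HodgeConjecture-24832`, h413 = `stmt-HodgeConjecture-24833`) until rung 0
closes; this file asserts no named fact and closes no socket.
References: [MoeglinWaldspurger1995] C. Mœglin, J.-L. Waldspurger, *Spectral Decomposition and Eisenstein Series*, II.1.1–II.1.4, II.2.4; [BernsteinLapid2019] J. Bernstein, E. Lapid, *On the
meromorphic continuation of Eisenstein series*, §4; [GelbartJacquet1979Corvallis] S. Gelbart, H. Jacquet, *Forms of GL(2) from the analytic point of view*, §3; [Garrett2018] P. Garrett,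
*Modern Analysis of Automorphic Forms by Example*, §2.2–§2.3.
-/

set_option autoImplicit false
set_option linter.dupNamespace false  -- the mandated namespace repeats the summit's segment (`HodgeConjecture.HodgeConjecture`)

noncomputable section

open MeasureTheory Measure Set Filter Topology NumberField
open Literature.MeasureTheory.Group Literature.NumberTheory.Automorphic Literature.NumberTheory.Automorphic.UnitaryGroup Literature.NumberTheory.GaloisRepresentations AdelicGroupData ContRepresentation
open Summit.HodgeConjecture.HodgeConjecture.Cruxes.H413.K2E1BorelEisensteinU
open Summit.HodgeConjecture.HodgeConjecture.Cruxes.H413.K2E1CharacterEisensteinU2Defs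
open Summit.HodgeConjecture.HodgeConjecture.Cruxes.H413.K2E1ChiSectionSpaceU2Defs
open Summit.HodgeConjecture.HodgeConjecture.Cruxes.H413.K2E1BorelCosetsDictionary (forall_arithmeticBorel_iff)
open Summit.HodgeConjecture.HodgeConjecture.Cruxes.H413.K2E1PseudoEisensteinCuspOrthogonal (memLp_two_pseudoEisenstein_automorphicQuotient)
open Summit.HodgeConjecture.HodgeConjecture.Cruxes.H413.K2E1PseudoEisensteinNiceGeneratorsU (orthogonal_inf_invariants_eq_topologicalClosure_span_nice)
open Summit.HodgeConjecture.HodgeConjecture.Cruxes.H413.K2E1PseudoEisensteinBorelPeriodizationU2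
open Summit.HodgeConjecture.HodgeConjecture.Cruxes.H413.K2E1PseudoEisensteinBorelPeriodizationContinuousU2
open Summit.HodgeConjecture.HodgeConjecture.Cruxes.H413.K2E1ChiIsotypicPureTensorDecompositionU2 (exists_sum_pureTensor_eq_norm_le)
open Summit.HodgeConjecture.HodgeConjecture.Cruxes.H413.K2E1EisensteinSupNormBandBoundCMTwo
open Summit.HodgeConjecture.HodgeConjecture.Cruxes.H413.K2E1BLIotaUnfoldingU (borelHeight_arithmeticBorel_mul')
open scoped ENNReal NNReal Pointwise

namespace Summit.HodgeConjecture.HodgeConjecture.Cruxes.H413.K2E1PseudoEisensteinFamilyDecompositionU2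

variable (L : Type) [Field L] [NumberField L] [IsCMField L]

/-! ## §1 Small adapters -/

/-- `N(𝔸)` is closed in `U(J₂)(𝔸_{L⁺})` (preimage of the closed upper-unitriangular group). [folklore] -/
theorem isClosed_adelicUnipotent_quasiSplit_cm :
    IsClosed ((adelicUnipotent (↥(maximalRealSubfield L)) L (IsCMField.complexConj L) 2 : Subgroup (quasiSplit (↥(maximalRealSubfield L)) L (IsCMField.complexConj L) 2).Adelic) :
      Set (quasiSplit (↥(maximalRealSubfield L)) L (IsCMField.complexConj L) 2).Adelic) := by
  haveI := t2Space_adeleRing_of_numberField L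
  change IsClosed (⇑(adelicVal (↥(maximalRealSubfield L)) L (IsCMField.complexConj L) 2 ((StdForm.antidiagonal 2).over L)) ⁻¹'
    ((Literature.NumberTheory.Automorphic.upperUnitriangular (Fin 2) (AdeleRing (𝓞 L) L) : Subgroup (GL (Fin 2) (AdeleRing (𝓞 L) L))) : Set (GL (Fin 2) (AdeleRing (𝓞 L) L))))
  exact (Literature.NumberTheory.Automorphic.isClosed_upperUnitriangular (R := AdeleRing (𝓞 L) L)).preimage continuous_subtype_val

section Generic

variable {F E : Type} [Field F] [NumberField F] [Field E] [NumberField E] [Algebra F E] {c : E ≃ₐ[F] E}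

/-- **A PURE TENSOR `f(H)·φ` (`φ` a `χ`-section) IS LEFT-`B(F)`-INVARIANT** (Track-A spelling; generic quadratic datum): `H` is left-`B(F)`-invariant and `χ(b₀₀) = 1` for rational `b`
(★ `IsChiSection.toAdelic_mul`). [cite: MoeglinWaldspurger1995, II.1.5] -/
theorem pureTensor_arithmeticBorel_mul {N : ℕ} [NeZero N] {χ : HeckeCharacter E} {K' : Subgroup (quasiSplit F E c N).Adelic}
    (f : ℝ → ℂ) {φ : (quasiSplit F E c N).Adelic → ℂ} (hφ : φ ∈ chiSectionSpace χ K' 1) :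
    ∀ b ∈ arithmeticBorel F E c N, ∀ g : (quasiSplit F E c N).Adelic,
      (fun g => f (borelHeight g) * φ g) ((b : (quasiSplit F E c N).Adelic) * g) = (fun g => f (borelHeight g) * φ g) g := by
  have hφB : ∀ b ∈ arithmeticBorel F E c N, ∀ x : (quasiSplit F E c N).Adelic, φ ((b : (quasiSplit F E c N).Adelic) * x) = φ x :=
    (forall_arithmeticBorel_iff (ψ := φ)).2 (isChiSection_of_mem hφ).toAdelic_mul
  intro b hb g
  show f (borelHeight ((b : (quasiSplit F E c N).Adelic) * g)) * φ (↑b * g) = f (borelHeight g) * φ g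
  rw [borelHeight_arithmeticBorel_mul' hb g, hφB b hb g]

/-- **BAND-CLASS LINEARITY FOR AN EXACT FINITE DECOMPOSITION** (`U(J₂)`, generic quadratic datum): if `ψ = Σ_i u_i` pointwise with `ψ` and all `u_i` left-`B(F)`-invariant and vanishing
where `H ≤ a` (`a > 0`), then `E ψ (g) = Σ_i E u_i (g)` (★ F3d-γ `eisensteinSeriesU_sub_finset_sum_of_band` applied to `ψ − Σ u_i = 0`). [cite: MoeglinWaldspurger1995, II.1.2] -/
theorem eisensteinSeriesU_eq_sum_of_eq_sum {ι : Type*} [Fintype ι] {ψ : (quasiSplit F E c 2).Adelic → ℂ} {u : ι → (quasiSplit F E c 2).Adelic → ℂ}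
    (hψB : ∀ b ∈ arithmeticBorel F E c 2, ∀ x, ψ ((b : (quasiSplit F E c 2).Adelic) * x) = ψ x)
    (huB : ∀ i, ∀ b ∈ arithmeticBorel F E c 2, ∀ x, u i ((b : (quasiSplit F E c 2).Adelic) * x) = u i x)
    {a : ℝ≥0} (ha : 0 < a) (hψa : ∀ g, borelHeight g ≤ a → ψ g = 0) (hua : ∀ i g, borelHeight g ≤ a → u i g = 0) (heq : ∀ g, ψ g = ∑ i, u i g)
    (g : (quasiSplit F E c 2).Adelic) :
    eisensteinSeriesU ψ g = ∑ i, eisensteinSeriesU (u i) g := by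
  classical
  have h := eisensteinSeriesU_sub_finset_sum_of_band (Finset.univ : Finset ι) (fun _ => (1 : ℂ)) hψB huB ha hψa hua g
  have h0 : (fun x => ψ x - ∑ j ∈ (Finset.univ : Finset ι), (1 : ℂ) * u j x) = fun _ => 0 := funext fun x => by simp only [one_mul, heq x, sub_self]
  rw [h0] at h
  have hz : eisensteinSeriesU (fun _ : (quasiSplit F E c 2).Adelic => (0 : ℂ)) g = 0 := by
    rw [eisensteinSeriesU_def]; exact tsum_zero
  rw [hz] at h
  simp only [one_mul] at h
  exact (sub_eq_zero.1 h.symm)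

end Generic

variable {L}

/-! ## §2 `[E P_χ]` lies in the span of the `χ`-family's pure-tensor classes -/

variable (μ : Measure (quasiSplit (↥(maximalRealSubfield L)) L (IsCMField.complexConj L) 2).automorphicQuotient)

/-- **`[quotFun (E P)] ∈ span { [quotFun (E (f(H)·φ))] : f ∈ C_c((0,∞)), φ ∈ chiSectionSpace χ K′ 1 }`** for a continuous, right-`K′`-invariant, left-`B(F)`-invariant, norm-one-Borel `χ`-isotypic,
bounded, band-supported `P` — ★ F3d-β `exists_sum_pureTensor_eq_norm_le` + §1 linearity + ★ F3d-γ `sum_smul_toLp_eq`; the `L²`-ness of every class through `hδ` (F3d-δ).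
[cite: MoeglinWaldspurger1995, I.2.17, II.1.1–II.1.2] -/
theorem toLp_quotFun_eisensteinSeriesU_mem_span_family (hc : IsCMField.complexConj L * IsCMField.complexConj L = 1)
    {K' : Subgroup (quasiSplit (↥(maximalRealSubfield L)) L (IsCMField.complexConj L) 2).Adelic} (hK'o : IsOpen (K' : Set (quasiSplit (↥(maximalRealSubfield L)) L (IsCMField.complexConj L) 2).Adelic))
    (hHK' : ∀ (g k : (quasiSplit (↥(maximalRealSubfield L)) L (IsCMField.complexConj L) 2).Adelic), k ∈ K' → borelHeight (g * k) = borelHeight g)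
    (hBK : ∃ W : Finset (quasiSplit (↥(maximalRealSubfield L)) L (IsCMField.complexConj L) 2).Adelic, ∀ g, ∃ β ∈ borelAdelic (↥(maximalRealSubfield L)) L (IsCMField.complexConj L) 2, ∃ w ∈ W, ∃ k ∈ K', g = β * w * k)
    (hδ : ∀ (u : (quasiSplit (↥(maximalRealSubfield L)) L (IsCMField.complexConj L) 2).Adelic → ℂ), Continuous u →
      (∀ b ∈ arithmeticBorel (↥(maximalRealSubfield L)) L (IsCMField.complexConj L) 2, ∀ x, u ((b : (quasiSplit (↥(maximalRealSubfield L)) L (IsCMField.complexConj L) 2).Adelic) * x) = u x) →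
      (∃ M : ℝ, ∀ g, ‖u g‖ ≤ M) → ∀ {a b : ℝ≥0}, 0 < a → (∀ g, u g ≠ 0 → a ≤ borelHeight g ∧ borelHeight g ≤ b) →
        MemLp ((quasiSplit (↥(maximalRealSubfield L)) L (IsCMField.complexConj L) 2).quotFun (eisensteinSeriesU u)) 2 μ)
    (χ : HeckeCharacter L) (hχray : ∀ r : ℝ≥0ˣ, χ (posRealIdele L r) = 1)
    {P : (quasiSplit (↥(maximalRealSubfield L)) L (IsCMField.complexConj L) 2).Adelic → ℂ} (hPc : Continuous P)
    (hPK : ∀ (g k : (quasiSplit (↥(maximalRealSubfield L)) L (IsCMField.complexConj L) 2).Adelic), k ∈ K' → P (g * k) = P g)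
    (hPB : ∀ b ∈ arithmeticBorel (↥(maximalRealSubfield L)) L (IsCMField.complexConj L) 2, ∀ x, P ((b : (quasiSplit (↥(maximalRealSubfield L)) L (IsCMField.complexConj L) 2).Adelic) * x) = P x)
    (hPχ : ∀ (b : (quasiSplit (↥(maximalRealSubfield L)) L (IsCMField.complexConj L) 2).Adelic) (hb : b ∈ borelAdelic (↥(maximalRealSubfield L)) L (IsCMField.complexConj L) 2),
      IdeleClassGroup.ideleNorm L (firstEntryUnit hb) = 1 → ∀ g, P (b * g) = ((χ (firstEntryUnit hb) : ℂˣ) : ℂ) * P g)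
    (hPM : ∃ M : ℝ, ∀ g, ‖P g‖ ≤ M) {a b : ℝ≥0} (ha : 0 < a) (hPband : ∀ g, P g ≠ 0 → a ≤ borelHeight g ∧ borelHeight g ≤ b)
    (hv : MemLp ((quasiSplit (↥(maximalRealSubfield L)) L (IsCMField.complexConj L) 2).quotFun (eisensteinSeriesU P)) 2 μ) :
    hv.toLp _ ∈ Submodule.span ℂ {v : (quasiSplit (↥(maximalRealSubfield L)) L (IsCMField.complexConj L) 2).L2 μ |
      ∃ (f : ℝ → ℂ) (_ : Continuous f) (_ : HasCompactSupport f) (_ : tsupport f ⊆ Ioi 0)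
        (φ : (quasiSplit (↥(maximalRealSubfield L)) L (IsCMField.complexConj L) 2).Adelic → ℂ) (_ : φ ∈ chiSectionSpace χ K' 1) (_ : Continuous φ)
        (hv : MemLp ((quasiSplit (↥(maximalRealSubfield L)) L (IsCMField.complexConj L) 2).quotFun (eisensteinSeriesU (fun g => f (borelHeight g) * φ g))) 2 μ), v = hv.toLp _} := by
  classical
  obtain ⟨M, hM⟩ := hPM
  obtain ⟨ι, hι, f, φ, hfφ, heq⟩ := exists_sum_pureTensor_eq_norm_le hc hK'o hHK' hBK χ hχray hPc hPK hPχ ha hPband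
  -- the terms `u_i = f_i(H)·φ_i`: continuous, `B(F)`-invariant, bounded, band-supported ⇒ `L²` classes
  set u : ι → (quasiSplit (↥(maximalRealSubfield L)) L (IsCMField.complexConj L) 2).Adelic → ℂ := fun i g => f i (borelHeight g) * φ i g with hu
  have huc : ∀ i, Continuous (u i) := fun i => ((hfφ i).1.comp (NNReal.continuous_coe.comp continuous_borelHeight)).mul (hfφ i).2.2.2.2.1
  have huB : ∀ i, ∀ b ∈ arithmeticBorel (↥(maximalRealSubfield L)) L (IsCMField.complexConj L) 2, ∀ x,
      u i ((b : (quasiSplit (↥(maximalRealSubfield L)) L (IsCMField.complexConj L) 2).Adelic) * x) = u i x := fun i => pureTensor_arithmeticBorel_mul (f i) (hfφ i).2.2.2.1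
  have huM : ∀ i, ∃ M' : ℝ, ∀ g, ‖u i g‖ ≤ M' := fun i => ⟨M, fun g => ((hfφ i).2.2.2.2.2 g).trans (hM g)⟩
  have huband : ∀ i g, u i g ≠ 0 → a ≤ borelHeight g ∧ borelHeight g ≤ b := fun i g hg => hPband g fun hP => hg (by
    have h := (hfφ i).2.2.2.2.2 g; rw [hP, norm_zero] at h; exact norm_le_zero_iff.1 h)
  have hvu : ∀ i, MemLp ((quasiSplit (↥(maximalRealSubfield L)) L (IsCMField.complexConj L) 2).quotFun (eisensteinSeriesU (u i))) 2 μ := fun i => hδ (u i) (huc i) (huB i) (huM i) ha (huband i)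
  -- `E P = Σ_i E u_i` pointwise (band class, threshold `a/2`)
  have ha2 : (0 : ℝ≥0) < a / 2 := half_pos ha
  have hPa : ∀ g, borelHeight g ≤ a / 2 → P g = 0 := fun g hg => by
    by_contra hne; exact absurd ((hPband g hne).1.trans hg) (not_le.2 (half_lt_self ha))
  have hua : ∀ i g, borelHeight g ≤ a / 2 → u i g = 0 := fun i g hg => by
    by_contra hne; exact absurd ((huband i g hne).1.trans hg) (not_le.2 (half_lt_self ha))
  have hE : ∀ g, eisensteinSeriesU P g = ∑ i, eisensteinSeriesU (u i) g := eisensteinSeriesU_eq_sum_of_eq_sum hPB huB ha2 hPa hua heq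
  -- the classes: `[E P] = Σ_i 1 • [E u_i]`
  obtain ⟨hs, hseq⟩ := sum_smul_toLp_eq (quasiSplit (↥(maximalRealSubfield L)) L (IsCMField.complexConj L) 2) μ (Finset.univ : Finset ι) (fun _ => (1 : ℂ))
    (fun i => eisensteinSeriesU (u i)) hvu
  have hcls : hv.toLp _ = ∑ i, (1 : ℂ) • (hvu i).toLp _ := by
    rw [hseq]
    exact MemLp.toLp_congr _ _ (Eventually.of_forall fun x => by
      simp only [AdelicGroupData.quotFun, one_mul, hE])
  rw [hcls]
  refine Submodule.sum_mem _ fun i _ => Submodule.smul_mem _ _ (Submodule.subset_span ?_)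
  exact ⟨f i, (hfφ i).1, (hfφ i).2.1, (hfφ i).2.2.1, φ i, (hfφ i).2.2.2.1, (hfφ i).2.2.2.2.1, hvu i, rfl⟩

/-! ## §3 THE C7 HEAD -/

/-- **ROADCARD C7 HEAD — `E^{K′} ⊆ closure Σ_χ E^{K′}_χ` with EXPLICIT GENERATORS**: for the CM pair `U(1,1)_{L∕L⁺}`, an automorphic `μ`, a closed `R`-stable `W ≤ L²(X)` with
`Wᗮ = closure span {[θ_Φ] : Φ ∈ 𝒯}` over Borel parabolic data (`hE`, `h𝔓`; `W = L²_cusp` by ★ f1), an open compact `K′` with `H` right-`K′`-invariant and finitely many `(B(𝔸),K′)`-double cosets,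
and the two bricks `hα` (F3d-α: uniform approximation by nice `χ`-isotypic functions on the compact torus quotient) and `hδ` (F3d-δ: nice Eisenstein classes are `L²`):
**`Wᗮ ∩ L²(X)^{K′} ≤ closure ( ⨆_{χ} span { [quotFun (E (f(H)·φ))] : f ∈ C_c((0,∞)) continuous, φ ∈ chiSectionSpace χ K′ 1 continuous } )`.**
Assembly: ★ P1b (nice `K′`-invariant generators) → ★ F3b (`[θ_Φ] = [quotFun (E ψ)]`) → ★ F3b′ (`ψ` nice) → `hα` → ★ F3d-γ (`L²` transfer) → ★ F3d-β + §2 (`[E P_χ]` in the `χ`-span).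
[cite: MoeglinWaldspurger1995, II.1.1–II.1.4, II.2.4] [cite: BernsteinLapid2019, §4] -/
theorem orthogonal_inf_invariants_le_topologicalClosure_iSup_family (hc : IsCMField.complexConj L * IsCMField.complexConj L = 1)
    [MeasurableSpace (quasiSplit (↥(maximalRealSubfield L)) L (IsCMField.complexConj L) 2).Adelic] [BorelSpace (quasiSplit (↥(maximalRealSubfield L)) L (IsCMField.complexConj L) 2).Adelic]
    [(quasiSplit (↥(maximalRealSubfield L)) L (IsCMField.complexConj L) 2).IsAutomorphicMeasure μ]
    (ν : Measure (quasiSplit (↥(maximalRealSubfield L)) L (IsCMField.complexConj L) 2).Adelic) [ν.IsHaarMeasure]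
    (𝔓 : (quasiSplit (↥(maximalRealSubfield L)) L (IsCMField.complexConj L) 2).ParabolicUnipotentData)
    (h𝔓 : ∀ i : 𝔓.ι, 𝔓.radical i = adelicUnipotent (↥(maximalRealSubfield L)) L (IsCMField.complexConj L) 2)
    (K' : Subgroup (quasiSplit (↥(maximalRealSubfield L)) L (IsCMField.complexConj L) 2).Adelic) (hK'o : IsOpen (K' : Set (quasiSplit (↥(maximalRealSubfield L)) L (IsCMField.complexConj L) 2).Adelic))
    (hK'c : IsCompact (K' : Set (quasiSplit (↥(maximalRealSubfield L)) L (IsCMField.complexConj L) 2).Adelic))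
    (hHK' : ∀ (g k : (quasiSplit (↥(maximalRealSubfield L)) L (IsCMField.complexConj L) 2).Adelic), k ∈ K' → borelHeight (g * k) = borelHeight g)
    (hBK : ∃ W : Finset (quasiSplit (↥(maximalRealSubfield L)) L (IsCMField.complexConj L) 2).Adelic, ∀ g, ∃ β ∈ borelAdelic (↥(maximalRealSubfield L)) L (IsCMField.complexConj L) 2, ∃ w ∈ W, ∃ k ∈ K', g = β * w * k)
    (μK : Measure ↥K') [IsProbabilityMeasure μK] [μK.IsMulLeftInvariant] [μK.IsMulRightInvariant] [μK.IsInvInvariant]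
    (W : ClosedSubrep ((quasiSplit (↥(maximalRealSubfield L)) L (IsCMField.complexConj L) 2).rightRegular μ)) {Θ : Set ((quasiSplit (↥(maximalRealSubfield L)) L (IsCMField.complexConj L) 2).L2 μ)}
    (hΘ : Θ = {f : (quasiSplit (↥(maximalRealSubfield L)) L (IsCMField.complexConj L) 2).L2 μ | ∃ (i : 𝔓.ι) (Φ : (quasiSplit (↥(maximalRealSubfield L)) L (IsCMField.complexConj L) 2).Adelic → ℂ)
        (_ : Measurable Φ) (_ : ∀ (g : (quasiSplit (↥(maximalRealSubfield L)) L (IsCMField.complexConj L) 2).Adelic) (n : 𝔓.radical i), Φ (g * n) = Φ g)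
        (_ : ∫⁻ x, (∑' q : (quasiSplit (↥(maximalRealSubfield L)) L (IsCMField.complexConj L) 2).quotientSubgroup ⧸ (𝔓.radical i).subgroupOf (quasiSplit (↥(maximalRealSubfield L)) L (IsCMField.complexConj L) 2).quotientSubgroup,
          ‖Φ ((Quotient.out x : (quasiSplit (↥(maximalRealSubfield L)) L (IsCMField.complexConj L) 2).Adelic) * ((q.out : (quasiSplit (↥(maximalRealSubfield L)) L (IsCMField.complexConj L) 2).quotientSubgroup) :
            (quasiSplit (↥(maximalRealSubfield L)) L (IsCMField.complexConj L) 2).Adelic))‖ₑ) ^ 2 ∂μ < ∞)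
        (hθ : MemLp (fun x : (quasiSplit (↥(maximalRealSubfield L)) L (IsCMField.complexConj L) 2).automorphicQuotient =>
          ∑' q : (quasiSplit (↥(maximalRealSubfield L)) L (IsCMField.complexConj L) 2).quotientSubgroup ⧸ (𝔓.radical i).subgroupOf (quasiSplit (↥(maximalRealSubfield L)) L (IsCMField.complexConj L) 2).quotientSubgroup,
          Φ ((Quotient.out x : (quasiSplit (↥(maximalRealSubfield L)) L (IsCMField.complexConj L) 2).Adelic) * ((q.out : (quasiSplit (↥(maximalRealSubfield L)) L (IsCMField.complexConj L) 2).quotientSubgroup) :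
            (quasiSplit (↥(maximalRealSubfield L)) L (IsCMField.complexConj L) 2).Adelic))) 2 μ), f = hθ.toLp _})
    (hE : (W.toSubmodule)ᗮ = (Submodule.span ℂ Θ).topologicalClosure)
    (hα : ∀ (ψ : (quasiSplit (↥(maximalRealSubfield L)) L (IsCMField.complexConj L) 2).Adelic → ℂ), Continuous ψ →
      (∀ (u : adelicUnipotent (↥(maximalRealSubfield L)) L (IsCMField.complexConj L) 2) (g : (quasiSplit (↥(maximalRealSubfield L)) L (IsCMField.complexConj L) 2).Adelic),
        ψ ((u : (quasiSplit (↥(maximalRealSubfield L)) L (IsCMField.complexConj L) 2).Adelic) * g) = ψ g) →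
      (∀ b ∈ arithmeticBorel (↥(maximalRealSubfield L)) L (IsCMField.complexConj L) 2, ∀ g, ψ ((b : (quasiSplit (↥(maximalRealSubfield L)) L (IsCMField.complexConj L) 2).Adelic) * g) = ψ g) →
      (∀ (g : (quasiSplit (↥(maximalRealSubfield L)) L (IsCMField.complexConj L) 2).Adelic) (k : K'), ψ (g * (k : (quasiSplit (↥(maximalRealSubfield L)) L (IsCMField.complexConj L) 2).Adelic)) = ψ g) →
      ∀ {a b : ℝ≥0}, 0 < a → (∀ g, ψ g ≠ 0 → a ≤ borelHeight g ∧ borelHeight g ≤ b) → ∀ ε : ℝ, 0 < ε →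
        ∃ (s : Finset (HeckeCharacter L)) (coef : HeckeCharacter L → ℂ) (P : HeckeCharacter L → (quasiSplit (↥(maximalRealSubfield L)) L (IsCMField.complexConj L) 2).Adelic → ℂ),
          (∀ χ ∈ s, (∀ r : ℝ≥0ˣ, χ (posRealIdele L r) = 1) ∧ Continuous (P χ) ∧
            (∀ (g : (quasiSplit (↥(maximalRealSubfield L)) L (IsCMField.complexConj L) 2).Adelic) (k : K'), P χ (g * (k : (quasiSplit (↥(maximalRealSubfield L)) L (IsCMField.complexConj L) 2).Adelic)) = P χ g) ∧
            (∀ b ∈ arithmeticBorel (↥(maximalRealSubfield L)) L (IsCMField.complexConj L) 2, ∀ g, P χ ((b : (quasiSplit (↥(maximalRealSubfield L)) L (IsCMField.complexConj L) 2).Adelic) * g) = P χ g) ∧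
            (∀ (b : (quasiSplit (↥(maximalRealSubfield L)) L (IsCMField.complexConj L) 2).Adelic) (hb : b ∈ borelAdelic (↥(maximalRealSubfield L)) L (IsCMField.complexConj L) 2),
              IdeleClassGroup.ideleNorm L (firstEntryUnit hb) = 1 → ∀ g, P χ (b * g) = ((χ (firstEntryUnit hb) : ℂˣ) : ℂ) * P χ g) ∧
            (∀ g, P χ g ≠ 0 → a ≤ borelHeight g ∧ borelHeight g ≤ b) ∧ (∃ M : ℝ, ∀ g, ‖P χ g‖ ≤ M)) ∧
          ∀ g, ‖ψ g - ∑ χ ∈ s, coef χ * P χ g‖ ≤ ε)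
    (hδ : ∀ (u : (quasiSplit (↥(maximalRealSubfield L)) L (IsCMField.complexConj L) 2).Adelic → ℂ), Continuous u →
      (∀ b ∈ arithmeticBorel (↥(maximalRealSubfield L)) L (IsCMField.complexConj L) 2, ∀ x, u ((b : (quasiSplit (↥(maximalRealSubfield L)) L (IsCMField.complexConj L) 2).Adelic) * x) = u x) →
      (∃ M : ℝ, ∀ g, ‖u g‖ ≤ M) → ∀ {a b : ℝ≥0}, 0 < a → (∀ g, u g ≠ 0 → a ≤ borelHeight g ∧ borelHeight g ≤ b) →
        MemLp ((quasiSplit (↥(maximalRealSubfield L)) L (IsCMField.complexConj L) 2).quotFun (eisensteinSeriesU u)) 2 μ) :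
    (W.toSubmodule)ᗮ ⊓ (((quasiSplit (↥(maximalRealSubfield L)) L (IsCMField.complexConj L) 2).rightRegular μ).restrict K'.subtype).invariants ≤
      (⨆ χ : HeckeCharacter L, Submodule.span ℂ {v : (quasiSplit (↥(maximalRealSubfield L)) L (IsCMField.complexConj L) 2).L2 μ |
        ∃ (f : ℝ → ℂ) (_ : Continuous f) (_ : HasCompactSupport f) (_ : tsupport f ⊆ Ioi 0)
          (φ : (quasiSplit (↥(maximalRealSubfield L)) L (IsCMField.complexConj L) 2).Adelic → ℂ) (_ : φ ∈ chiSectionSpace χ K' 1) (_ : Continuous φ)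
          (hv : MemLp ((quasiSplit (↥(maximalRealSubfield L)) L (IsCMField.complexConj L) 2).quotFun (eisensteinSeriesU (fun g => f (borelHeight g) * φ g))) 2 μ), v = hv.toLp _}).topologicalClosure := by
  classical
  -- structural instances of the CM quasi-split datum
  haveI := t2Space_adeleRing_of_numberField L
  haveI := locallyCompactSpace_adeleRing' L
  haveI := secondCountableTopology_adeleRing L
  haveI : LocallyCompactSpace (quasiSplit (↥(maximalRealSubfield L)) L (IsCMField.complexConj L) 2).Adelic :=
    inferInstanceAs (LocallyCompactSpace (adelic (↥(maximalRealSubfield L)) L (IsCMField.complexConj L) 2 ((StdForm.antidiagonal 2).over L)))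
  haveI : SecondCountableTopology (quasiSplit (↥(maximalRealSubfield L)) L (IsCMField.complexConj L) 2).Adelic :=
    inferInstanceAs (SecondCountableTopology (adelic (↥(maximalRealSubfield L)) L (IsCMField.complexConj L) 2 ((StdForm.antidiagonal 2).over L)))
  haveI : T2Space (quasiSplit (↥(maximalRealSubfield L)) L (IsCMField.complexConj L) 2).Adelic :=
    inferInstanceAs (T2Space (adelic (↥(maximalRealSubfield L)) L (IsCMField.complexConj L) 2 ((StdForm.antidiagonal 2).over L)))
  haveI : DiscreteTopology (quasiSplit (↥(maximalRealSubfield L)) L (IsCMField.complexConj L) 2).quotientSubgroup := by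
    rw [quotientSubgroup_quasiSplit]; exact isDiscreteRational_quasiSplit
  haveI : CompactSpace ↥K' := isCompact_iff_compactSpace.1 hK'c
  -- ★ P1b: the nice `K′`-invariant generators
  have hN : ∀ i : 𝔓.ι, IsClosed ((𝔓.radical i : Subgroup (quasiSplit (↥(maximalRealSubfield L)) L (IsCMField.complexConj L) 2).Adelic) :
      Set (quasiSplit (↥(maximalRealSubfield L)) L (IsCMField.complexConj L) 2).Adelic) := fun i => by rw [h𝔓 i]; exact isClosed_adelicUnipotent_quasiSplit_cm L
  have hP1 := orthogonal_inf_invariants_eq_topologicalClosure_span_nice (quasiSplit (↥(maximalRealSubfield L)) L (IsCMField.complexConj L) 2) 𝔓 μ ν μK K'.subtype hN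
    continuous_subtype_val W hΘ rfl rfl hE
  rw [hP1]
  refine Submodule.topologicalClosure_minimal _ (Submodule.span_le.2 ?_) (Submodule.isClosed_topologicalClosure _)
  rintro v ⟨i, Φ, hΦm, hΦ, h2, hΦc, ⟨M, hM⟩, ⟨C, hC, hCΦ⟩, hK, hθ, rfl⟩
  show hθ.toLp _ ∈ ((_ : Submodule ℂ ((quasiSplit (↥(maximalRealSubfield L)) L (IsCMField.complexConj L) 2).L2 μ)).topologicalClosure : Set _)
  rw [Submodule.topologicalClosure_coe, Metric.mem_closure_iff]
  intro ε hε
  -- `Φ` in the Borel currency; `ψ = (Φ_B)^∨` and its niceness (★ F3b, ★ F3b′)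
  have hΦ' : ∀ (g : (quasiSplit (↥(maximalRealSubfield L)) L (IsCMField.complexConj L) 2).Adelic) (u : adelicUnipotent (↥(maximalRealSubfield L)) L (IsCMField.complexConj L) 2), Φ (g * u) = Φ g :=
    fun g u => hΦ g ⟨u, by rw [h𝔓 i]; exact u.2⟩
  have hCΦ' : ∀ g, g ∉ C * ((adelicUnipotent (↥(maximalRealSubfield L)) L (IsCMField.complexConj L) 2 : Subgroup _) : Set _) → Φ g = 0 := fun g hg => hCΦ g (by rwa [h𝔓 i])
  set ψ : (quasiSplit (↥(maximalRealSubfield L)) L (IsCMField.complexConj L) 2).Adelic → ℂ := fun h =>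
    ∑' q : ↥(arithmeticBorel (↥(maximalRealSubfield L)) L (IsCMField.complexConj L) 2) ⧸
        ((adelicUnipotent (↥(maximalRealSubfield L)) L (IsCMField.complexConj L) 2).subgroupOf (quasiSplit (↥(maximalRealSubfield L)) L (IsCMField.complexConj L) 2).arithmeticSubgroup).subgroupOf
          (arithmeticBorel (↥(maximalRealSubfield L)) L (IsCMField.complexConj L) 2),
      Φ (h⁻¹ * (((q.out : arithmeticBorel (↥(maximalRealSubfield L)) L (IsCMField.complexConj L) 2) : (quasiSplit (↥(maximalRealSubfield L)) L (IsCMField.complexConj L) 2).arithmeticSubgroup) :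
        (quasiSplit (↥(maximalRealSubfield L)) L (IsCMField.complexConj L) 2).Adelic)) with hψdef
  have hψc : Continuous ψ := continuous_inv_periodization hΦc hC hCΦ'
  have hψU : ∀ (u : adelicUnipotent (↥(maximalRealSubfield L)) L (IsCMField.complexConj L) 2) (g : (quasiSplit (↥(maximalRealSubfield L)) L (IsCMField.complexConj L) 2).Adelic),
      ψ ((u : (quasiSplit (↥(maximalRealSubfield L)) L (IsCMField.complexConj L) 2).Adelic) * g) = ψ g := fun u g => inv_periodization_unipotent_mul hΦ' u g
  have hψB : ∀ b ∈ arithmeticBorel (↥(maximalRealSubfield L)) L (IsCMField.complexConj L) 2, ∀ g,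
      ψ ((b : (quasiSplit (↥(maximalRealSubfield L)) L (IsCMField.complexConj L) 2).Adelic) * g) = ψ g := inv_periodization_borel_mul hΦ'
  have hψK : ∀ (g : (quasiSplit (↥(maximalRealSubfield L)) L (IsCMField.complexConj L) 2).Adelic) (k : K'),
      ψ (g * (k : (quasiSplit (↥(maximalRealSubfield L)) L (IsCMField.complexConj L) 2).Adelic)) = ψ g := fun g k => inv_periodization_mul_right K'.subtype hK g k
  obtain ⟨a, b, ha, hband⟩ := exists_band_of_inv_periodization_ne_zero (Φ := Φ) hC hCΦ'
  obtain ⟨Mψ, hMψ⟩ := exists_bound_inv_periodization hΦc hΦ' hC hCΦ'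
  have hvψ : MemLp ((quasiSplit (↥(maximalRealSubfield L)) L (IsCMField.complexConj L) 2).quotFun (eisensteinSeriesU ψ)) 2 μ := hδ ψ hψc hψB ⟨Mψ, hMψ⟩ ha hband
  have hvθ : hθ.toLp _ = hvψ.toLp _ := toLp_pseudoEisenstein_eq_toLp_quotFun_eisensteinSeriesU 𝔓 i (h𝔓 i) μ hΦm hΦ h2
  -- ★ F3d-γ's constant at threshold `a/2`
  have ha2 : (0 : ℝ≥0) < a / 2 := half_pos ha
  obtain ⟨Cγ, hCγ0, hCγ⟩ := exists_const_norm_toLp_sub_sum_le_cm L μ ha2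
  set Kc : ℝ := (measureUnivNNReal μ : ℝ) ^ (2 : ℝ)⁻¹ * Cγ with hKc
  have hKc0 : 0 ≤ Kc := mul_nonneg (Real.rpow_nonneg (NNReal.coe_nonneg _) _) hCγ0
  -- the approximation from `hα` at `ε' = ε / (Kc + 1)`
  have hε' : 0 < ε / (Kc + 1) := div_pos hε (by linarith)
  obtain ⟨s, coef, P, hP, happrox⟩ := hα ψ hψc hψU hψB hψK ha hband (ε / (Kc + 1)) hε'
  -- `L²` classes of the `P_χ`, `χ ∈ s`
  have hvP : ∀ j : ↥s, MemLp ((quasiSplit (↥(maximalRealSubfield L)) L (IsCMField.complexConj L) 2).quotFun (eisensteinSeriesU (P (j : HeckeCharacter L)))) 2 μ := fun j =>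
    hδ (P j) (hP j j.2).2.1 (hP j j.2).2.2.2.1 (hP j j.2).2.2.2.2.2.2 ha (hP j j.2).2.2.2.2.2.1
  -- the approximant and its membership in `⨆_χ span(gen χ)`
  set y : (quasiSplit (↥(maximalRealSubfield L)) L (IsCMField.complexConj L) 2).L2 μ := ∑ j : ↥s, coef (j : HeckeCharacter L) • (hvP j).toLp _ with hy
  have hyV : y ∈ (⨆ χ : HeckeCharacter L, Submodule.span ℂ {v : (quasiSplit (↥(maximalRealSubfield L)) L (IsCMField.complexConj L) 2).L2 μ |
        ∃ (f : ℝ → ℂ) (_ : Continuous f) (_ : HasCompactSupport f) (_ : tsupport f ⊆ Ioi 0)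
          (φ : (quasiSplit (↥(maximalRealSubfield L)) L (IsCMField.complexConj L) 2).Adelic → ℂ) (_ : φ ∈ chiSectionSpace χ K' 1) (_ : Continuous φ)
          (hv : MemLp ((quasiSplit (↥(maximalRealSubfield L)) L (IsCMField.complexConj L) 2).quotFun (eisensteinSeriesU (fun g => f (borelHeight g) * φ g))) 2 μ), v = hv.toLp _}) := by
    refine Submodule.sum_mem _ fun j _ => Submodule.smul_mem _ _ (Submodule.mem_iSup_of_mem (j : HeckeCharacter L) ?_)
    obtain ⟨hχray, hPc, hPK, hPB, hPχ, hPband, hPM⟩ := hP j j.2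
    exact toLp_quotFun_eisensteinSeriesU_mem_span_family μ hc hK'o hHK' hBK hδ (j : HeckeCharacter L) hχray hPc (fun g k hk => hPK g ⟨k, hk⟩) hPB hPχ hPM ha hPband (hvP j)
  refine ⟨y, hyV, ?_⟩
  -- the distance estimate (★ F3d-γ)
  have hψa : ∀ g, borelHeight g ≤ a / 2 → ψ g = 0 := fun g hg => by
    by_contra hne; exact absurd ((hband g hne).1.trans hg) (not_le.2 (half_lt_self ha))
  have hPa : ∀ (j : ↥s) g, borelHeight g ≤ a / 2 → P (j : HeckeCharacter L) g = 0 := fun j g hg => by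
    by_contra hne; exact absurd (((hP j j.2).2.2.2.2.2.1 g hne).1.trans hg) (not_le.2 (half_lt_self ha))
  have happrox' : ∀ g, ‖ψ g - ∑ j ∈ (Finset.univ : Finset ↥s), coef (j : HeckeCharacter L) * P (j : HeckeCharacter L) g‖ ≤ ε / (Kc + 1) := fun g => by
    rw [Finset.sum_coe_sort s (fun χ => coef χ * P χ g)]; exact happrox g
  have hdist := hCγ (Finset.univ : Finset ↥s) (fun j => coef (j : HeckeCharacter L)) ψ (fun j => P (j : HeckeCharacter L)) hψB (fun j => (hP j j.2).2.2.2.1) hψa hPa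
    (ε / (Kc + 1)) happrox' hvψ hvP
  rw [dist_eq_norm, hvθ, hy]
  calc ‖hvψ.toLp _ - ∑ j : ↥s, coef (j : HeckeCharacter L) • (hvP j).toLp _‖ ≤ (measureUnivNNReal μ : ℝ) ^ (2 : ℝ)⁻¹ * Cγ * (ε / (Kc + 1)) := hdist
    _ = Kc * (ε / (Kc + 1)) := by rw [hKc]
    _ < ε := by
        rw [mul_div_assoc', div_lt_iff₀ (by linarith)]
        nlinarith

end Summit.HodgeConjecture.HodgeConjecture.Cruxes.H413.K2E1PseudoEisensteinFamilyDecompositionU2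

end
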